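import Literature.MathematicalPhysics.QuantumLattice.SourcedHubbardRegionCut
import Literature.MathematicalPhysics.QuantumLattice.TranslateRegionBookkeeping
import Literature.MathematicalPhysics.QuantumLattice.HubbardCouplingTransport
import Literature.MathematicalPhysics.QuantumLattice.FockRelabel
import HarnessLib

/-!
# Region energies of translation-invariant pair-sourced Hubbard Hamiltonians on the torus are extensive
# up to a boundary term (Ruelle's boundary estimate, both directions)

Topic `MathematicalPhysics/QuantumLattice` (sequel of `SourcedHubbardRegionCut.lean`, `TranslateRegionBookkeeping.lean`;
written for the cell `hubbard-cq`, negation lens N-W0-LOCAL / census (13): the lattice half of the site-local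
sourced ε-lift barrier). On the fermionic torus `FermionTorus 2 L` (sites compared with `(ℤ/Lℤ)²` through
`toTorusSite / ofTorusSite`) take TRANSLATION-INVARIANT couplings: hopping `c_{(x,y,σ)} = κ(y − x)` and pair
weights `w_{(x,y)} = ω(y − x)` for step functions `κ, ω : (ℤ/Lℤ)² → ℂ` (the `t–t'–U` Hubbard model with the
`d`-wave pair source is `κ = 1` on `±eᵢ`, `tp` on `±e₁±e₂`, `ω = ĝ_d/√2` on `±eᵢ`), and the region Hamiltonians
`H_A = tiSourcedOn L κ ω U μ h A = sourcedOn (stepCoupling L κ) (stepWeight L ω) U μ h A` (all terms inside `A`).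
PROVED:

* translation covariance `relabel_translate_tiSourcedOn`: `T_v H_A T_v⁻¹ = H_{A+v}` (`shiftRegion`), hence
  `groundEnergy_tiSourcedOn_shiftRegion`: `E₀(H_{A+v}) = E₀(H_A)`;
* the expectation of `H_A` in any vector is a REGION FUNCTIONAL of `TranslateRegionBookkeeping`
  (`re_expect_tiSourcedOn_eq_regionSum`), whose pair part vanishes beyond the range set
  `rangeSet κ ω = {δ : κ δ ≠ 0 ∨ ω δ ≠ 0}` and is bounded by `K δ = 2‖κ δ‖ + 4|h|‖ω δ‖` in a unit vector;
* **upper bound** `groundEnergy_tiSourcedOn_le`: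
  `E₀(H_B) ≤ (|B|/N) E₀(H_Λ) + C · |∂_R B|`, `N = L²`, `C = Σ_δ (2‖κ δ‖ + 4|h|‖ω δ‖)` (`boundaryConst`),
  `∂_R B` the inner `R`-boundary of the image of `B` in `(ℤ/Lℤ)²` (`torusBoundary`);
* **lower bound** `groundEnergy_tiSourcedOn_ge` (Ruelle's cut of `SourcedHubbardRegionCut` + the upper bound for
  the complement): `(|A|/N) E₀(H_Λ) − C · |∂_R (Λ∖A)| ≤ E₀(H_A)` for EVERY region `A` — the energy of the
  terms inside an arbitrary region, on the FULL Fock space, is at least its volume share of the torus ground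
  energy minus a boundary term; no gap, no uniqueness, no shape condition on `A`.

References: D. Ruelle, *Statistical Mechanics: Rigorous Results* (1969), §2.2–2.3, §3.3 (restriction to a region,
`|W| ≤ C|∂Λ|`, sub-box variational principle) [cite: Ruelle1969, §2.3]; O. Bratteli, D. W. Robinson, *Operator
Algebras and QSM II* (1997), §5.2.2 (Bogoliubov relabelling automorphisms), §6.2.4 (surface energies)
[cite: BratteliRobinsonII1997, §6.2.4]; T. Koma, H. Tasaki, J. Stat. Phys. 76 (1994) 745, §1 (pair-sourced
Hamiltonian) [cite: KomaTasaki1994, §1]. All statements are [folklore].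

Tree: `sourcedOn`, `groundEnergy_sourcedOn_univ_le_add` (`SourcedHubbardRegionCut`), `regionSum`,
`le_of_forall_le_regionSum_translateRegion` (`TranslateRegionBookkeeping`), `relabel_hopSum`, `relabel_onSiteOp`,
`bondEquiv` (`HubbardCouplingTransport`), `Orb.translate`, `fockRelabel`, `relabel_eq_fockRelabel_conj` (`FockRelabel`),
`expect_add/_smul/_sum` (`PairCorrelationsProofs`), `norm_bondPair_le_two`, `norm_creation_le_one`,
`norm_add_conjTranspose_le_two_mul` — all REUSED. `lean search 'tiSourcedOn|stepCoupling|shiftRegion'`: nothing.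
-/

noncomputable section

open Matrix Finset Literature.Barriers.HubbardSuperconductivity Literature.Probability.LatticeModels
open scoped ComplexOrder Matrix.Norms.L2Operator

namespace Literature.MathematicalPhysics.QuantumLattice

open FermionTorus

/-! ### Generic tools: unitary invariance of `E₀`, unit ground vectors, `|⟨ψ, Dψ⟩| ≤ ‖D‖` -/

section Tools

variable {n : Type*} [Fintype n] [DecidableEq n]

/-- `E₀(U A Uᴴ) = E₀(A)` for unitary `U`. [folklore] -/
private theorem groundEnergy_unitary_conj' {A U : Matrix n n ℂ} (hU : U ∈ Matrix.unitaryGroup n ℂ) :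
    (U * A * Uᴴ).groundEnergy = A.groundEnergy := by
  unfold Matrix.groundEnergy ContinuousLinearMap.groundEnergy
  rw [spectrum_toEuclideanCLM, spectrum_toEuclideanCLM]
  have h := Unitary.spectrum_star_right_conjugate (R := ℂ) (a := A) (U := ⟨U, hU⟩)
  change spectrum ℂ (U * A * star U) = spectrum ℂ A at h
  rw [star_eq_conjTranspose] at h
  rw [h]

/-- A Hermitian matrix has a unit ground vector: `‖ψ‖ = 1`, `Re⟨ψ, Aψ⟩ = E₀(A)`. [folklore] -/
private theorem exists_unit_rayleigh_eq_groundEnergy [Nonempty n] {A : Matrix n n ℂ} (hA : A.IsHermitian) :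
    ∃ ψ : n → ℂ, star ψ ⬝ᵥ ψ = 1 ∧ (star ψ ⬝ᵥ (A *ᵥ ψ)).re = A.groundEnergy := by
  obtain ⟨v, hv, hv0⟩ := (Submodule.ne_bot_iff _).1 (groundSpace_ne_bot_holds hA)
  have hpos : 0 < ‖(WithLp.toLp 2 v : EuclideanSpace ℂ n)‖ := by
    rw [norm_pos_iff]
    intro h
    exact hv0 (by simpa using congrArg WithLp.ofLp h)
  set ψ : n → ℂ := ((‖(WithLp.toLp 2 v : EuclideanSpace ℂ n)‖ : ℂ))⁻¹ • v with hψ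
  have hψmem : ψ ∈ A.groundSpace := A.groundSpace.smul_mem _ hv
  have hψ1 : star ψ ⬝ᵥ ψ = 1 := by
    have h1 : inner ℂ (WithLp.toLp 2 v : EuclideanSpace ℂ n) (WithLp.toLp 2 v) = star v ⬝ᵥ v := by
      rw [EuclideanSpace.inner_eq_star_dotProduct, dotProduct_comm]
    have hvv : star v ⬝ᵥ v = ((‖(WithLp.toLp 2 v : EuclideanSpace ℂ n)‖ : ℂ)) ^ 2 := by
      rw [← h1, inner_self_eq_norm_sq_to_K]
      rfl
    rw [hψ, star_smul, smul_dotProduct, dotProduct_smul, hvv, smul_eq_mul, smul_eq_mul]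
    have hc0 : ((‖(WithLp.toLp 2 v : EuclideanSpace ℂ n)‖ : ℂ)) ≠ 0 := by exact_mod_cast hpos.ne'
    simp only [Complex.star_def, map_inv₀, Complex.conj_ofReal]
    field_simp
  exact ⟨ψ, hψ1, (rayleigh_eq_groundEnergy_iff_holds hA ψ hψ1).2 hψmem⟩

/-- `|⟨ψ, D ψ⟩| ≤ ‖D‖` for a unit vector (`ℓ²` operator norm). [folklore] -/
private theorem norm_expect_le_opNorm {ψ : n → ℂ} (hψ : star ψ ⬝ᵥ ψ = 1) (D : Matrix n n ℂ) :
    ‖star ψ ⬝ᵥ (D *ᵥ ψ)‖ ≤ ‖D‖ := by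
  have hinner : ∀ a b : n → ℂ, star a ⬝ᵥ b = inner ℂ (WithLp.toLp 2 a : EuclideanSpace ℂ n) (WithLp.toLp 2 b) :=
    fun a b => by rw [EuclideanSpace.inner_eq_star_dotProduct, dotProduct_comm]
  have hnorm : ‖(WithLp.toLp 2 ψ : EuclideanSpace ℂ n)‖ = 1 := by
    have h := inner_self_eq_norm_sq_to_K (𝕜 := ℂ) (WithLp.toLp 2 ψ : EuclideanSpace ℂ n)
    rw [← hinner, hψ] at h
    have h2 : (‖(WithLp.toLp 2 ψ : EuclideanSpace ℂ n)‖ : ℝ) ^ 2 = 1 := by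
      have h3 : (((‖(WithLp.toLp 2 ψ : EuclideanSpace ℂ n)‖ ^ 2 : ℝ)) : ℂ) = 1 := by
        rw [Complex.ofReal_pow]; exact h.symm
      exact_mod_cast h3
    nlinarith [norm_nonneg (WithLp.toLp 2 ψ : EuclideanSpace ℂ n)]
  rw [hinner]
  refine (norm_inner_le_norm _ _).trans ?_
  have h := Matrix.l2_opNorm_mulVec D (WithLp.toLp 2 ψ : EuclideanSpace ℂ n)
  rw [hnorm, one_mul]
  calc ‖(WithLp.toLp 2 (D *ᵥ ψ) : EuclideanSpace ℂ n)‖ ≤ ‖D‖ * ‖(WithLp.toLp 2 ψ : EuclideanSpace ℂ n)‖ := h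
    _ = ‖D‖ := by rw [hnorm, mul_one]

/-- `|Re⟨ψ, D ψ⟩| ≤ ‖D‖` for a unit vector. [folklore] -/
private theorem abs_re_expect_le_opNorm {ψ : n → ℂ} (hψ : star ψ ⬝ᵥ ψ = 1) (D : Matrix n n ℂ) :
    |(star ψ ⬝ᵥ (D *ᵥ ψ)).re| ≤ ‖D‖ :=
  (Complex.abs_re_le_norm _).trans (norm_expect_le_opNorm hψ D)

end Tools

/-! ### The sourced form as a sum of on-site and ordered-pair terms (generic site set) -/

section PairTerm

variable {Λ : Type*} [LinearOrder Λ] [Fintype Λ]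

/-- The two-site term of the ordered pair `(x, y)`: `Σ_σ c_{(x,y,σ)} T_{(x,y,σ)} + h (w_{xy} b_{xy} + (w_{xy} b_{xy})ᴴ)`
(hoppings of both spins and the singlet pair with its adjoint). [cite: Ruelle1969, §2.2] -/
def pairTerm (c : Bond Λ → ℂ) (w : Λ × Λ → ℂ) (h : ℝ) (x y : Λ) : Matrix (Finset (Orb Λ)) (Finset (Orb Λ)) ℂ :=
  (∑ σ : Fin 2, c (x, y, σ) • bondOp (x, y, σ)) + (h : ℂ) • (w (x, y) • bondPair x y + (w (x, y) • bondPair x y)ᴴ)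

omit [LinearOrder Λ] in
/-- `Σ_x Σ_y 1[x ∈ A ∧ y ∈ A] F x y = Σ_{x ∈ A} Σ_{y ∈ A} F x y`. [folklore] -/
private theorem sum_sum_ite_mem_and {M : Type*} [AddCommMonoid M] [DecidableEq Λ] (A : Finset Λ) (F : Λ → Λ → M) :
    ∑ x, ∑ y, (if x ∈ A ∧ y ∈ A then F x y else 0) = ∑ x ∈ A, ∑ y ∈ A, F x y := by
  have h1 : ∀ x, ∑ y, (if x ∈ A ∧ y ∈ A then F x y else 0) = if x ∈ A then ∑ y ∈ A, F x y else 0 := by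
    intro x
    by_cases hx : x ∈ A
    · simp only [hx, true_and, if_true]
      rw [← Finset.sum_filter]
      congr 1
      ext y; simp
    · simp [hx]
  rw [Finset.sum_congr rfl fun x _ => h1 x, ← Finset.sum_filter]
  congr 1
  ext x; simp

/-- **`H_A = Σ_{x ∈ A} V_x − Σ_{x ∈ A} Σ_{y ∈ A} (two-site term of (x, y))`.** [cite: Ruelle1969, §2.2] -/
theorem sourcedOn_eq_sum_sub_sum_pairTerm (c : Bond Λ → ℂ) (w : Λ × Λ → ℂ) (U μ h : ℝ) (A : Finset Λ) :
    sourcedOn c w U μ h A =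
      ∑ x ∈ A, onSiteOp (U : ℂ) (μ : ℂ) x - ∑ x ∈ A, ∑ y ∈ A, pairTerm c w h x y := by
  classical
  have hT : hopSum (restrictCoupling A c) = ∑ x ∈ A, ∑ y ∈ A, ∑ σ : Fin 2, c (x, y, σ) • bondOp (x, y, σ) := by
    rw [hopSum, Fintype.sum_prod_type, ← sum_sum_ite_mem_and A]
    refine Finset.sum_congr rfl fun x _ => ?_
    rw [Fintype.sum_prod_type]
    refine Finset.sum_congr rfl fun y _ => ?_
    split_ifs with hxy
    · exact Finset.sum_congr rfl fun σ _ => by rw [restrictCoupling_apply, if_pos hxy]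
    · exact Finset.sum_eq_zero fun σ _ => by rw [restrictCoupling_apply, if_neg hxy, zero_smul]
  have hP : (∑ z : Λ × Λ, restrictWeight A w z • bondPair z.1 z.2) = ∑ x ∈ A, ∑ y ∈ A, w (x, y) • bondPair x y := by
    rw [Fintype.sum_prod_type, ← sum_sum_ite_mem_and A]
    refine Finset.sum_congr rfl fun x _ => Finset.sum_congr rfl fun y _ => ?_
    split_ifs with hxy
    · rw [restrictWeight_apply, if_pos hxy]
    · rw [restrictWeight_apply, if_neg hxy, zero_smul]
  rw [sourcedOn, onSiteSum, hT, hP, conjTranspose_sum]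
  simp only [conjTranspose_sum, pairTerm, Finset.sum_add_distrib, Finset.smul_sum, smul_add]
  abel

/-- The expectation functional is subtractive. [folklore] -/
private theorem expect_sub' {ι : Type*} [LinearOrder ι] [Fintype ι] (A B : Matrix (Finset ι) (Finset ι) ℂ) (ψ : Fock ι) :
    expect (A - B) ψ = expect A ψ - expect B ψ := by
  simp [QuantumLattice.expect, sub_mulVec, dotProduct_sub]

/-- The expectation functional commutes with finite sums. [folklore] -/
private theorem expect_sum' {ι α : Type*} [LinearOrder ι] [Fintype ι] (s : Finset α)
    (A : α → Matrix (Finset ι) (Finset ι) ℂ) (ψ : Fock ι) : expect (∑ a ∈ s, A a) ψ = ∑ a ∈ s, expect (A a) ψ := by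
  simp [QuantumLattice.expect, sum_mulVec, dotProduct_sum]

/-- **The expectation of `H_A` as a region functional**:
`Re⟨ψ, H_A ψ⟩ = Σ_{x ∈ A} Re⟨V_x⟩ − Σ_{x ∈ A} Σ_{y ∈ A} Re⟨two-site term (x,y)⟩`. [cite: Ruelle1969, §2.2] -/
theorem re_expect_sourcedOn (c : Bond Λ → ℂ) (w : Λ × Λ → ℂ) (U μ h : ℝ) (A : Finset Λ) (ψ : Fock (Orb Λ)) :
    (expect (sourcedOn c w U μ h A) ψ).re =
      ∑ x ∈ A, (expect (onSiteOp (U : ℂ) (μ : ℂ) x) ψ).re - ∑ x ∈ A, ∑ y ∈ A, (expect (pairTerm c w h x y) ψ).re := by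
  rw [sourcedOn_eq_sum_sub_sum_pairTerm, expect_sub', expect_sum', expect_sum', Complex.sub_re, Complex.re_sum,
    Complex.re_sum]
  congr 1
  exact Finset.sum_congr rfl fun x _ => by rw [expect_sum', Complex.re_sum]

/-- `‖T_b‖ ≤ 1`. [folklore] -/
private theorem norm_bondOp_le_one' (b : Bond Λ) : ‖bondOp b‖ ≤ 1 :=
  (norm_mul_le _ _).trans (mul_le_one₀ (norm_creation_le_one _) (norm_nonneg _) (norm_annihilation_le_one _))

/-- **Norm of the two-site term**: `‖pairTerm‖ ≤ Σ_σ ‖c_{(x,y,σ)}‖ + 4|h| ‖w_{xy}‖`. [cite: Ruelle1969, §2.3] -/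
theorem norm_pairTerm_le (c : Bond Λ → ℂ) (w : Λ × Λ → ℂ) (h : ℝ) (x y : Λ) :
    ‖pairTerm c w h x y‖ ≤ (∑ σ : Fin 2, ‖c (x, y, σ)‖) + 4 * |h| * ‖w (x, y)‖ := by
  unfold pairTerm
  refine (norm_add_le _ _).trans (add_le_add ?_ ?_)
  · refine (norm_sum_le _ _).trans (Finset.sum_le_sum fun σ _ => ?_)
    rw [norm_smul]
    exact (mul_le_mul_of_nonneg_left (norm_bondOp_le_one' _) (norm_nonneg _)).trans (by rw [mul_one])
  · rw [norm_smul, Complex.norm_real, Real.norm_eq_abs]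
    have h1 := norm_add_conjTranspose_le_two_mul (w (x, y) • bondPair x y)
    have h2 : ‖w (x, y) • bondPair x y‖ ≤ ‖w (x, y)‖ * 2 := by
      rw [norm_smul]; exact mul_le_mul_of_nonneg_left (norm_bondPair_le_two _ _) (norm_nonneg _)
    calc |h| * ‖w (x, y) • bondPair x y + (w (x, y) • bondPair x y)ᴴ‖ ≤ |h| * (2 * (‖w (x, y)‖ * 2)) :=
          mul_le_mul_of_nonneg_left (h1.trans (by linarith)) (abs_nonneg h)
      _ = 4 * |h| * ‖w (x, y)‖ := by ring

omit [Fintype Λ] in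
/-- The two-site term vanishes when all its couplings do (finite range of the interaction). [cite: Ruelle1969, §2.2] -/
theorem pairTerm_eq_zero_of [Fintype Λ] {c : Bond Λ → ℂ} {w : Λ × Λ → ℂ} (h : ℝ) {x y : Λ}
    (hc : ∀ σ, c (x, y, σ) = 0) (hw : w (x, y) = 0) : pairTerm c w h x y = 0 := by
  unfold pairTerm
  simp [hc, hw]

end PairTerm

/-! ### Translation-invariant couplings on the fermionic torus -/

section Torus

/-- ONE `DecidableEq (FermionTorus 2 L)` instance for this file: the generic CAR-algebra / region lemmas carry
`LinearOrder.toDecidableEq`, while instance resolution on the concrete torus would find the computable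
`instDecidableEqLex`; with two names for the same instance the complements `Aᶜ` produced here and by the
generic cut lemma would not match syntactically (same convention as `DWaveKomaTasakiSystem.lean`). [folklore] -/
local instance (priority := high) instDecidableEqFermionTorusRegion {L : ℕ} :
    DecidableEq (FermionTorus 2 L) :=
  LinearOrder.toDecidableEq

variable (L : ℕ) [NeZero L]

/-- **Translation-invariant hopping couplings** on the fermionic torus: `c_{(x,y,σ)} = κ(y − x)` for a step
function `κ : (ℤ/Lℤ)² → ℂ`. [cite: Ruelle1969, §2.2] -/
def stepCoupling (κ : TorusSite 2 L → ℂ) : Bond (FermionTorus 2 L) → ℂ :=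
  fun b => κ (toTorusSite b.2.1 - toTorusSite b.1)

/-- **Translation-invariant pair weights**: `w_{(x,y)} = ω(y − x)`. [cite: KomaTasaki1994, §1] -/
def stepWeight (ω : TorusSite 2 L → ℂ) : FermionTorus 2 L × FermionTorus 2 L → ℂ :=
  fun z => ω (toTorusSite z.2 - toTorusSite z.1)

/-- The translation-invariant pair-sourced Hubbard Hamiltonian on the torus RESTRICTED TO THE REGION `A`
(`H_A`: on-site terms of `A`, hoppings `κ` and pairs `ω` with both ends in `A`). [cite: Ruelle1969, §2.2] -/
def tiSourcedOn (κ ω : TorusSite 2 L → ℂ) (U μ h : ℝ) (A : Finset (FermionTorus 2 L)) :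
    Matrix (Finset (Orb (FermionTorus 2 L))) (Finset (Orb (FermionTorus 2 L))) ℂ :=
  sourcedOn (stepCoupling L κ) (stepWeight L ω) U μ h A

/-- The translate `A + v` of a region of the fermionic torus. [cite: Ruelle1969, §2.2] -/
def shiftRegion (v : TorusSite 2 L) (A : Finset (FermionTorus 2 L)) : Finset (FermionTorus 2 L) :=
  A.map (ofTorusEquiv (Equiv.addRight v)).toEmbedding

/-- The range set of the couplings: steps carrying a hopping or a pair. [cite: Ruelle1969, §2.2] -/
def rangeSet (κ ω : TorusSite 2 L → ℂ) : Finset (TorusSite 2 L) :=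
  Finset.univ.filter fun δ => κ δ ≠ 0 ∨ ω δ ≠ 0

/-- The boundary constant `C = Σ_δ (2‖κ δ‖ + 4|h| ‖ω δ‖)` (the norm of all two-site terms through a site).
[cite: Ruelle1969, §2.3] -/
def boundaryConst (κ ω : TorusSite 2 L → ℂ) (h : ℝ) : ℝ := ∑ δ : TorusSite 2 L, (2 * ‖κ δ‖ + 4 * |h| * ‖ω δ‖)

/-- The `R`-boundary of a region of the fermionic torus: sites of `A` with a coupled step leaving `A`
(computed on the image of `A` in `(ℤ/Lℤ)²`). [cite: Ruelle1969, §2.3] -/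
def torusBoundary (κ ω : TorusSite 2 L → ℂ) (A : Finset (FermionTorus 2 L)) : Finset (TorusSite 2 L) :=
  stepBoundary (rangeSet L κ ω) (A.map (equivTorusSite (d := 2) (L := L)).toEmbedding)

variable {L}
variable (κ ω : TorusSite 2 L → ℂ) (U μ h : ℝ)

omit [NeZero L] in
/-- Bond-reversal symmetry of step couplings: `κ(−δ) = conj κ(δ)` gives `c_{(y,x,σ)} = conj c_{(x,y,σ)}`.
[cite: Ruelle1969, §2.2] -/
theorem stepCoupling_symm {κ : TorusSite 2 L → ℂ} (hκ : ∀ δ, star (κ δ) = κ (-δ)) (x y : FermionTorus 2 L)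
    (σ : Fin 2) : star (stepCoupling L κ (x, y, σ)) = stepCoupling L κ (y, x, σ) := by
  simp only [stepCoupling, hκ, neg_sub]

omit [NeZero L] in
/-- `H_A` is Hermitian for bond-reversal symmetric `κ` and real `U, μ, h`. [cite: Ruelle1969, §2.2] -/
theorem isHermitian_tiSourcedOn {κ : TorusSite 2 L → ℂ} (hκ : ∀ δ, star (κ δ) = κ (-δ)) (ω : TorusSite 2 L → ℂ)
    (U μ h : ℝ) (A : Finset (FermionTorus 2 L)) : (tiSourcedOn L κ ω U μ h A).IsHermitian :=
  isHermitian_sourcedOn _ U μ h (stepCoupling_symm hκ) A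

/-! #### Regions and their translates -/

/-- The inverse shift `x ↦ x − v` of the torus translation. [cite: BratteliRobinsonII1997, §5.2.2] -/
theorem ofTorusEquiv_addRight_symm_apply (v : TorusSite 2 L) (x : FermionTorus 2 L) :
    (ofTorusEquiv (Equiv.addRight v)).symm x = ofTorusSite (toTorusSite x - v) := by
  rw [Equiv.symm_apply_eq, ofTorusEquiv_ofTorusSite]
  simp

/-- Membership in a translate. [cite: Ruelle1969, §2.2] -/
theorem mem_shiftRegion (v : TorusSite 2 L) (A : Finset (FermionTorus 2 L)) (x : FermionTorus 2 L) :
    x ∈ shiftRegion L v A ↔ ofTorusSite (toTorusSite x - v) ∈ A := by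
  rw [shiftRegion, Finset.mem_map_equiv, ofTorusEquiv_addRight_symm_apply]

/-- Translates have the same cardinality. [cite: Ruelle1969, §2.2] -/
@[simp] theorem card_shiftRegion (v : TorusSite 2 L) (A : Finset (FermionTorus 2 L)) :
    (shiftRegion L v A).card = A.card := Finset.card_map _

/-- The translate of a complement is the complement of the translate. [cite: Ruelle1969, §2.2] -/
theorem shiftRegion_compl (v : TorusSite 2 L) (A : Finset (FermionTorus 2 L)) :
    shiftRegion L v Aᶜ = (shiftRegion L v A)ᶜ := by
  ext x; simp only [mem_shiftRegion, Finset.mem_compl]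

/-- The image of a translate in `(ℤ/Lℤ)²` is the translate of the image. [cite: Ruelle1969, §2.2] -/
theorem map_shiftRegion (v : TorusSite 2 L) (A : Finset (FermionTorus 2 L)) :
    (shiftRegion L v A).map (equivTorusSite (d := 2) (L := L)).toEmbedding =
      translateRegion v (A.map (equivTorusSite (d := 2) (L := L)).toEmbedding) := by
  ext y
  rw [Finset.mem_map_equiv, mem_shiftRegion, mem_translateRegion, Finset.mem_map_equiv]
  simp [equivTorusSite]

/-! #### Translation covariance -/

/-- Step couplings restricted to a region, pulled back along the shift, are the step couplings restricted to
the translate. [cite: Ruelle1969, §2.2] -/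
theorem restrictCoupling_stepCoupling_comp_symm (v : TorusSite 2 L) (A : Finset (FermionTorus 2 L)) :
    restrictCoupling A (stepCoupling L κ) ∘ (bondEquiv (ofTorusEquiv (Equiv.addRight v))).symm =
      restrictCoupling (shiftRegion L v A) (stepCoupling L κ) := by
  funext b
  obtain ⟨x, y, σ⟩ := b
  simp only [Function.comp_apply, bondEquiv, Equiv.prodCongr_symm, Equiv.refl_symm, Equiv.prodCongr_apply,
    Prod.map_apply, Equiv.refl_apply, restrictCoupling_apply, stepCoupling, mem_shiftRegion,
    ofTorusEquiv_addRight_symm_apply, toTorusSite_ofTorusSite, sub_sub_sub_cancel_right]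

/-- The same for the pair weights. [cite: Ruelle1969, §2.2] -/
theorem restrictWeight_stepWeight_symm (v : TorusSite 2 L) (A : Finset (FermionTorus 2 L)) (x y : FermionTorus 2 L) :
    restrictWeight A (stepWeight L ω) ((ofTorusEquiv (Equiv.addRight v)).symm x, (ofTorusEquiv (Equiv.addRight v)).symm y) =
      restrictWeight (shiftRegion L v A) (stepWeight L ω) (x, y) := by
  simp only [restrictWeight_apply, stepWeight, mem_shiftRegion, ofTorusEquiv_addRight_symm_apply,
    toTorusSite_ofTorusSite, sub_sub_sub_cancel_right]

/-- Relabelling a singlet pair: `Γ_f b_{xy} Γ_f⁻¹ = b_{f x, f y}`. [cite: BratteliRobinsonII1997, §5.2.2] -/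
theorem relabel_mapEquiv_bondPair {Λ Λ' : Type*} [LinearOrder Λ] [Fintype Λ] [LinearOrder Λ'] [Fintype Λ']
    (f : Λ ≃ Λ') (x y : Λ) : relabel (Orb.mapEquiv f) (bondPair x y) = bondPair (f x) (f y) := by
  unfold bondPair
  rw [map_sub, map_mul, map_mul, relabel_annihilation, relabel_annihilation, relabel_annihilation,
    relabel_annihilation, Orb.mapEquiv_orb, Orb.mapEquiv_orb, Orb.mapEquiv_orb, Orb.mapEquiv_orb]

/-- Relabelling a restricted pair sum along a site bijection reindexes it. [cite: BratteliRobinsonII1997, §5.2.2] -/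
theorem relabel_mapEquiv_pairSum {Λ : Type*} [LinearOrder Λ] [Fintype Λ] (f : Λ ≃ Λ) (w : Λ × Λ → ℂ) :
    relabel (Orb.mapEquiv f) (∑ z : Λ × Λ, w z • bondPair z.1 z.2) =
      ∑ z : Λ × Λ, w (f.symm z.1, f.symm z.2) • bondPair z.1 z.2 := by
  rw [relabel_sum]
  simp_rw [relabel_smul, relabel_mapEquiv_bondPair]
  exact Fintype.sum_equiv (Equiv.prodCongr f f) _ _ fun z => by simp

/-- **Translation covariance of the region Hamiltonians**: `T_v H_A T_v⁻¹ = H_{A+v}`.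
[cite: BratteliRobinsonII1997, §5.2.2] -/
theorem relabel_translate_tiSourcedOn (v : TorusSite 2 L) (A : Finset (FermionTorus 2 L)) :
    relabel (Orb.translate v) (tiSourcedOn L κ ω U μ h A) = tiSourcedOn L κ ω U μ h (shiftRegion L v A) := by
  set f : FermionTorus 2 L ≃ FermionTorus 2 L := ofTorusEquiv (Equiv.addRight v) with hf
  have htr : Orb.translate v = Orb.mapEquiv f := rfl
  rw [htr, tiSourcedOn, tiSourcedOn, sourcedOn, sourcedOn, relabel_sub, relabel_sub, relabel_smul, relabel_add,
    relabel_conjTranspose, relabel_hopSum, restrictCoupling_stepCoupling_comp_symm, relabel_mapEquiv_pairSum]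
  have hV : relabel (Orb.mapEquiv f) (onSiteSum (U : ℂ) (μ : ℂ) A) = onSiteSum (U : ℂ) (μ : ℂ) (shiftRegion L v A) := by
    rw [onSiteSum, relabel_sum, onSiteSum, shiftRegion, Finset.sum_map]
    exact Finset.sum_congr rfl fun x _ => relabel_onSiteOp f _ _ x
  have hW : (∑ z : FermionTorus 2 L × FermionTorus 2 L,
      restrictWeight A (stepWeight L ω) (f.symm z.1, f.symm z.2) • bondPair z.1 z.2) =
      ∑ z : FermionTorus 2 L × FermionTorus 2 L, restrictWeight (shiftRegion L v A) (stepWeight L ω) z • bondPair z.1 z.2 :=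
    Finset.sum_congr rfl fun z _ => by rw [hf, restrictWeight_stepWeight_symm]
  rw [hV, hW]

/-- `E₀` is invariant under relabelling. [cite: BratteliRobinsonII1997, §5.2.2] -/
theorem groundEnergy_relabel_perm {ι : Type*} [LinearOrder ι] [Fintype ι] (π : Equiv.Perm ι)
    (X : Matrix (Finset ι) (Finset ι) ℂ) : (relabel π X).groundEnergy = X.groundEnergy := by
  rw [relabel_eq_fockRelabel_conj]
  exact groundEnergy_unitary_conj' (fockRelabel π).2

/-- **`E₀(H_{A+v}) = E₀(H_A)`.** [cite: Ruelle1969, §2.2] -/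
theorem groundEnergy_tiSourcedOn_shiftRegion (v : TorusSite 2 L) (A : Finset (FermionTorus 2 L)) :
    (tiSourcedOn L κ ω U μ h (shiftRegion L v A)).groundEnergy = (tiSourcedOn L κ ω U μ h A).groundEnergy := by
  have h1 := groundEnergy_relabel_perm (Orb.translate v) (tiSourcedOn L κ ω U μ h A)
  rw [relabel_translate_tiSourcedOn] at h1
  convert h1 using 2

/-! #### The expectation of `H_A` as a region functional on `(ℤ/Lℤ)²` -/

/-- On-site expectation at the torus site `x` (real part). [cite: Ruelle1969, §2.2] -/
def onSiteExpect (ψ : Fock (Orb (FermionTorus 2 L))) (x : TorusSite 2 L) : ℝ :=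
  (expect (onSiteOp (U : ℂ) (μ : ℂ) (ofTorusSite x)) ψ).re

/-- Ordered-pair expectation at the torus sites `(x, y)` (real part). [cite: Ruelle1969, §2.2] -/
def pairExpect (ψ : Fock (Orb (FermionTorus 2 L))) (x y : TorusSite 2 L) : ℝ :=
  (expect (pairTerm (stepCoupling L κ) (stepWeight L ω) h (ofTorusSite x) (ofTorusSite y)) ψ).re

/-- **`Re⟨ψ, H_A ψ⟩ = regionSum (on-site expectations) (pair expectations) (image of A in (ℤ/Lℤ)²)`.**
[cite: Ruelle1969, §2.2] -/
theorem re_expect_tiSourcedOn_eq_regionSum (ψ : Fock (Orb (FermionTorus 2 L))) (A : Finset (FermionTorus 2 L)) :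
    (expect (tiSourcedOn L κ ω U μ h A) ψ).re =
      regionSum (onSiteExpect U μ ψ) (pairExpect κ ω h ψ) (A.map (equivTorusSite (d := 2) (L := L)).toEmbedding) := by
  rw [tiSourcedOn, re_expect_sourcedOn, regionSum, Finset.sum_map, Finset.sum_map]
  simp [Finset.sum_map, onSiteExpect, pairExpect, equivTorusSite]

/-- The pair expectation vanishes beyond the range set. [cite: Ruelle1969, §2.3] -/
theorem pairExpect_eq_zero_of_not_mem (ψ : Fock (Orb (FermionTorus 2 L))) {δ : TorusSite 2 L}
    (hδ : δ ∉ rangeSet L κ ω) (x : TorusSite 2 L) : pairExpect κ ω h ψ x (x + δ) = 0 := by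
  simp only [rangeSet, Finset.mem_filter, Finset.mem_univ, true_and, not_or, not_not] at hδ
  have h0 : pairTerm (stepCoupling L κ) (stepWeight L ω) h (ofTorusSite x) (ofTorusSite (x + δ)) = 0 :=
    pairTerm_eq_zero_of h (fun σ => by simp [stepCoupling, hδ.1]) (by simp [stepWeight, hδ.2])
  rw [pairExpect, h0, QuantumLattice.expect, zero_mulVec, dotProduct_zero, Complex.zero_re]

/-- The pair expectation in a unit vector is bounded by `K δ = 2‖κ δ‖ + 4|h|‖ω δ‖`. [cite: Ruelle1969, §2.3] -/
theorem abs_pairExpect_le {ψ : Fock (Orb (FermionTorus 2 L))} (hψ : star ψ ⬝ᵥ ψ = 1) (δ x : TorusSite 2 L) :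
    |pairExpect κ ω h ψ x (x + δ)| ≤ 2 * ‖κ δ‖ + 4 * |h| * ‖ω δ‖ := by
  rw [pairExpect, QuantumLattice.expect]
  refine (abs_re_expect_le_opNorm hψ _).trans ((norm_pairTerm_le _ _ h _ _).trans (le_of_eq ?_))
  simp [stepCoupling, stepWeight, two_mul]

/-! #### The two bounds -/

omit [NeZero L] in
/-- `|A| + |Λ∖A| = N` in `ℝ`. [folklore] -/
private theorem card_add_card_compl_real (A : Finset (FermionTorus 2 L)) :
    (A.card : ℝ) + (Aᶜ.card : ℝ) = Fintype.card (FermionTorus 2 L) := by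
  rw [Finset.card_compl]; push_cast [Nat.cast_sub (Finset.card_le_univ A)]; ring

/-- The two site types of the torus have the same cardinality. [folklore] -/
private theorem card_fermionTorus_eq : Fintype.card (FermionTorus 2 L) = Fintype.card (TorusSite 2 L) :=
  Fintype.card_congr (equivTorusSite (d := 2) (L := L))

/-- **Upper bound (Ruelle's boundary estimate)**: for bond-reversal symmetric `κ`, real `U, μ, h` and every region
`B` of the torus, `E₀(H_B) ≤ (|B|/N) · E₀(H_Λ) + C · |∂_R B|` with `N` the number of sites,
`C = boundaryConst`, `∂_R B = torusBoundary` — average the variational bound `E₀(H_B) = E₀(H_{B+v}) ≤ ⟨ψ, H_{B+v} ψ⟩`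
(ψ a ground vector of `H_Λ`) over all translations `v`. [cite: Ruelle1969, §2.3] -/
theorem groundEnergy_tiSourcedOn_le {κ : TorusSite 2 L → ℂ} (hκ : ∀ δ, star (κ δ) = κ (-δ)) (ω : TorusSite 2 L → ℂ)
    (U μ h : ℝ) (B : Finset (FermionTorus 2 L)) :
    (tiSourcedOn L κ ω U μ h B).groundEnergy ≤
      (B.card : ℝ) / Fintype.card (FermionTorus 2 L) * (tiSourcedOn L κ ω U μ h Finset.univ).groundEnergy +
        (torusBoundary L κ ω B).card * boundaryConst L κ ω h := by
  -- a unit ground vector of the full Hamiltonian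
  obtain ⟨ψ, hψ1, hψE⟩ := exists_unit_rayleigh_eq_groundEnergy (isHermitian_tiSourcedOn hκ ω U μ h Finset.univ)
  set e := (equivTorusSite (d := 2) (L := L)).toEmbedding with he
  -- the bookkeeping, with `E = E₀(H_B)`
  have hmain := le_of_forall_le_regionSum_translateRegion (onSiteExpect U μ ψ) (pairExpect κ ω h ψ) (B.map e)
    (rangeSet L κ ω) (fun δ => 2 * ‖κ δ‖ + 4 * |h| * ‖ω δ‖)
    (fun δ hδ x => pairExpect_eq_zero_of_not_mem κ ω h ψ hδ x) (fun δ _ x => abs_pairExpect_le κ ω h hψ1 δ x)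
    (E := (tiSourcedOn L κ ω U μ h B).groundEnergy) (fun v => by
      rw [he, ← map_shiftRegion, ← re_expect_tiSourcedOn_eq_regionSum, ← groundEnergy_tiSourcedOn_shiftRegion κ ω U μ h v B]
      exact groundEnergy_le_rayleigh_holds (isHermitian_tiSourcedOn hκ ω U μ h _) ψ hψ1)
  -- identify the pieces
  have huniv : regionSum (onSiteExpect U μ ψ) (pairExpect κ ω h ψ) Finset.univ =
      (tiSourcedOn L κ ω U μ h Finset.univ).groundEnergy := by
    rw [← hψE, ← Finset.map_univ_equiv (equivTorusSite (d := 2) (L := L)), ← he]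
    exact (re_expect_tiSourcedOn_eq_regionSum κ ω U μ h ψ Finset.univ).symm
  have hC : ∑ δ ∈ rangeSet L κ ω, (2 * ‖κ δ‖ + 4 * |h| * ‖ω δ‖) = boundaryConst L κ ω h := by
    rw [boundaryConst, ← Finset.sum_subset (Finset.subset_univ (rangeSet L κ ω))]
    intro δ _ hδ
    simp only [rangeSet, Finset.mem_filter, Finset.mem_univ, true_and, not_or, not_not] at hδ
    simp [hδ.1, hδ.2]
  rw [huniv, hC, Finset.card_map, he, ← card_fermionTorus_eq] at hmain
  exact hmain

/-- **Lower bound**: for bond-reversal symmetric `κ`, real `U, μ, h` and EVERY region `A` of the torus,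
`(|A|/N) · E₀(H_Λ) − C · |∂_R (Λ∖A)| ≤ E₀(H_A)` — the energy of the interaction terms inside an arbitrary region
(on the full Fock space) is at least its volume share of the torus ground energy minus a boundary term
(Ruelle's cut `E₀(H_Λ) ≤ E₀(H_A) + E₀(H_{Λ∖A})` and the upper bound for the complement).
[cite: Ruelle1969, §3.3] -/
theorem groundEnergy_tiSourcedOn_ge {κ : TorusSite 2 L → ℂ} (hκ : ∀ δ, star (κ δ) = κ (-δ)) (ω : TorusSite 2 L → ℂ)
    (U μ h : ℝ) (A : Finset (FermionTorus 2 L)) :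
    (A.card : ℝ) / Fintype.card (FermionTorus 2 L) * (tiSourcedOn L κ ω U μ h Finset.univ).groundEnergy -
        (torusBoundary L κ ω Aᶜ).card * boundaryConst L κ ω h ≤
      (tiSourcedOn L κ ω U μ h A).groundEnergy := by
  have hcut := groundEnergy_sourcedOn_ge_univ_sub_compl (stepCoupling_symm hκ) (stepWeight L ω) U μ h A
  have hup := groundEnergy_tiSourcedOn_le hκ ω U μ h Aᶜ
  have hN : (0 : ℝ) < Fintype.card (FermionTorus 2 L) := by
    have : 0 < Fintype.card (FermionTorus 2 L) := Fintype.card_pos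
    exact_mod_cast this
  have hcard := card_add_card_compl_real A
  -- `E₀(H_Λ) − E₀(H_{Aᶜ}) ≥ E₀(H_Λ) − (|Aᶜ|/N) E₀(H_Λ) − C|∂Aᶜ| = (|A|/N) E₀(H_Λ) − C|∂Aᶜ|`
  have hfrac : (A.card : ℝ) / Fintype.card (FermionTorus 2 L) = 1 - (Aᶜ.card : ℝ) / Fintype.card (FermionTorus 2 L) := by
    field_simp
    linarith
  simp only [tiSourcedOn] at hup ⊢
  rw [hfrac]
  have hexp : (1 - (Aᶜ.card : ℝ) / Fintype.card (FermionTorus 2 L)) *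
      (sourcedOn (stepCoupling L κ) (stepWeight L ω) U μ h Finset.univ).groundEnergy =
      (sourcedOn (stepCoupling L κ) (stepWeight L ω) U μ h Finset.univ).groundEnergy -
        (Aᶜ.card : ℝ) / Fintype.card (FermionTorus 2 L) *
          (sourcedOn (stepCoupling L κ) (stepWeight L ω) U μ h Finset.univ).groundEnergy := by ring
  rw [hexp]
  linarith [hcut, hup]

/-- **Lower bound, energy-density form**: with `e = E₀(H_Λ)/N`,
`|A| · e − C · |∂_R (Λ∖A)| ≤ E₀(H_A)`. [cite: Ruelle1969, §3.3] -/
theorem groundEnergy_tiSourcedOn_ge' {κ : TorusSite 2 L → ℂ} (hκ : ∀ δ, star (κ δ) = κ (-δ)) (ω : TorusSite 2 L → ℂ)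
    (U μ h : ℝ) (A : Finset (FermionTorus 2 L)) :
    (A.card : ℝ) * ((tiSourcedOn L κ ω U μ h Finset.univ).groundEnergy / Fintype.card (FermionTorus 2 L)) -
        (torusBoundary L κ ω Aᶜ).card * boundaryConst L κ ω h ≤
      (tiSourcedOn L κ ω U μ h A).groundEnergy := by
  have hge := groundEnergy_tiSourcedOn_ge hκ ω U μ h A
  have hre : (A.card : ℝ) * ((tiSourcedOn L κ ω U μ h Finset.univ).groundEnergy / Fintype.card (FermionTorus 2 L)) =
      (A.card : ℝ) / Fintype.card (FermionTorus 2 L) * (tiSourcedOn L κ ω U μ h Finset.univ).groundEnergy := by ring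
  rw [hre]
  exact hge

end Torus

end Literature.MathematicalPhysics.QuantumLattice
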